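import Literature.Computability.MetaComplexity.EFSemModular
import Literature.Computability.MetaComplexity.EFPlainMul
import HarnessLib

/-!
# Semantics of the plain multiplier: `Plain.Mul.mulPT` computes `a · b mod 2^L`

Continuing `EFSemantics.lean` / `EFSemModular.lean`, the words of the shift-and-add integer
multiplier `Plain.Mul.mulPT L` (`EFPlainMul.lean`; inputs `a`, `b` of `L` bits and a zero input
`zz`; `R₀ = 0`, `R_{t+1} = R_t + mask(b_t, a << t)` with carries above `L` discarded) on honest
inputs (`zz = 0`):

* `Plain.Mul.wval_ash` — the shifted word `a << t` carries `a · 2^t mod 2^L`;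
* `Plain.Mul.wval_msk` — the mask of stage `t` carries `b_t · (a · 2^t mod 2^L)`;
* `Plain.Mul.valR_eq` — the partial sums carry `R_t = a · (b mod 2^t) mod 2^L`;
* `Plain.Mul.wval_mulPT` — **the output word `R_L` carries `a · b mod 2^L`**, i.e. `a · b` when
  the product does not overflow (`Plain.Mul.wval_mulPT_of_lt`).

## Sources

* H. Vollmer, *Introduction to Circuit Complexity* (Springer 1999), §1.2 (multiplication as
  iterated addition of shifted masks), Def. 1.7 (semantics of circuits).
-/

namespace Literature.Computability.MetaComplexity

open _root_.Computability Complexity Complexity.PropForm Netlist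

namespace Plain.Mul

variable (L : ℕ) (inp : ℕ → Bool)

/-! ### The values -/

/-- `a` (inputs `0 … L-1`). [folklore] -/
def valA : ℕ := wval (fun i => inp i) L
/-- `b` (inputs `L … 2L-1`). [folklore] -/
def valB : ℕ := wval (fun i => inp (L + i)) L
/-- The value read through a reference. [folklore] -/
def rv (r : ℕ ⊕ ℕ) : Bool := refVal inp (wireVal (mulPT L) inp) r
/-- The number carried by the partial sum `R_t`. [folklore] -/
def valR (t : ℕ) : ℕ := wval (fun j => rv L inp (RRef L t j)) L

/-! ### The pieces -/

/-- The wires of piece `k < 2L`. [cite: Vollmer1999, Def. 1.7] -/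
theorem wireVal_piece {k : ℕ} (hk : k < 2 * L) {j : ℕ} (hj : j < (pieces L k).T.length) :
    wireVal (mulPT L) inp (offF L k + j) = wireVal (pieces L k).T (fun i => rv L inp ((pieces L k).wire i)) j := by
  have h := wireVal_layout (pieces L) (N := 2 * L) (piece_ok L) inp hk hj
  rw [offset_pieces] at h
  exact h

/-- Offsets of the two pieces of stage `t`. [folklore] -/
theorem offF_stage (t : ℕ) : offF L (2 * t) = t * PS L ∧ offF L (2 * t + 1) = t * PS L + L := by
  unfold offF; constructor
  · rw [show 2 * t / 2 = t by omega, if_pos (by omega), Nat.add_zero]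
  · rw [show (2 * t + 1) / 2 = t by omega, if_neg (by omega)]

/-- **The shifted word** `a << t` (zero fill from `zz = 0`) carries `a · 2^t mod 2^L`. [cite: Vollmer1999, §1.2] -/
theorem wval_ash (hzz : inp (2 * L) = false) (t : ℕ) :
    wval (fun j => rv L inp (ashRef L t j)) L = valA L inp * 2 ^ t % 2 ^ L := by
  have h : wval (fun j => rv L inp (ashRef L t j)) L = wval (fun j => (valA L inp * 2 ^ t).testBit j) L :=
    wval_congr fun j hj => by
      unfold rv ashRef valA
      rw [Nat.testBit_mul_two_pow]
      split_ifs with h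
      · simp only [refVal, h, decide_true, Bool.true_and]; exact (testBit_wval _ (by omega)).symm
      · simp [refVal, hzz, h]
  rw [h, wval_testBit]

/-- **The mask row of stage `t`** carries `b_t ∧ (a << t)_j`. [cite: Vollmer1999, Def. 1.7] -/
theorem wireVal_msk {t : ℕ} (ht : t < L) {j : ℕ} (hj : j < L) :
    wireVal (mulPT L) inp (t * PS L + j) = (inp (L + t) && rv L inp (ashRef L t j)) := by
  have h := wireVal_piece L inp (k := 2 * t) (by omega) (j := j) (by rw [(pieces_eq t).1]; simpa using hj)
  rw [(pieces_eq t).1, (offF_stage L t).1] at h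
  rw [h, ModMulU.wireVal_maskRow L _ hj]
  simp [rv, refVal, Nat.add_comm 1 j]

/-- The mask word of stage `t` carries `b_t · (a · 2^t mod 2^L)`. [cite: Vollmer1999, §1.2] -/
theorem wval_msk (hzz : inp (2 * L) = false) {t : ℕ} (ht : t < L) :
    wval (fun j => wireVal (mulPT L) inp (t * PS L + j)) L = (inp (L + t)).toNat * (valA L inp * 2 ^ t % 2 ^ L) := by
  rw [← wval_ash L inp hzz t]
  cases hb : inp (L + t)
  · simp only [Bool.toNat_false, Nat.zero_mul]
    exact wval_eq_zero fun j hj => by rw [wireVal_msk L inp ht hj, hb, Bool.false_and]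
  · simp only [Bool.toNat_true, Nat.one_mul]
    exact wval_congr fun j hj => by rw [wireVal_msk L inp ht hj, hb, Bool.true_and]

/-- The inputs read by the adder of stage `t`: `(R_t, mask_t)`. [folklore] -/
def inpADD (t : ℕ) (i : ℕ) : Bool := if i < L then rv L inp (RRef L t i) else wireVal (mulPT L) inp (t * PS L + (i - L))

/-- **The adder of stage `t`** carries the wires of `addT false L` on `(R_t, mask_t)`. [cite: Vollmer1999, Def. 1.7] -/
theorem wireVal_ADD {t : ℕ} (ht : t < L) {j : ℕ} (hj : j < (Adder.addT false L).length) :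
    wireVal (mulPT L) inp (t * PS L + L + j) = wireVal (Adder.addT false L) (inpADD L inp t) j := by
  have h := wireVal_piece L inp (k := 2 * t + 1) (by omega) (j := j) (by rw [(pieces_eq t).2]; exact hj)
  rw [(pieces_eq t).2, (offF_stage L t).2] at h
  refine h.trans (wireVal_congr (Adder.wf_addT false L) (fun i hi => ?_) hj)
  show rv L inp (if i < L then RRef L t i else Sum.inr (t * PS L + (i - L))) = inpADD L inp t i
  unfold inpADD; split_ifs <;> rfl

/-- `R_0` is the zero word. [folklore] -/
theorem valR_zero (hzz : inp (2 * L) = false) : valR L inp 0 = 0 :=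
  wval_eq_zero fun j _ => by simp [rv, RRef, refVal, hzz]

/-- **One stage**: `R_{t+1} = (R_t + b_t · (a 2^t mod 2^L)) mod 2^L`. [cite: Vollmer1999, §1.2] -/
theorem valR_succ (hzz : inp (2 * L) = false) {t : ℕ} (ht : t < L) :
    valR L inp (t + 1) = (valR L inp t + (inp (L + t)).toNat * (valA L inp * 2 ^ t % 2 ^ L)) % 2 ^ L := by
  have hA := Adder.wval_sum_addT false L (inpADD L inp t)
  have hx : wval (fun i => inpADD L inp t i) L = valR L inp t := wval_congr fun i hi => by unfold inpADD; rw [if_pos hi]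
  have hy : wval (fun i => inpADD L inp t (L + i)) L = (inp (L + t)).toNat * (valA L inp * 2 ^ t % 2 ^ L) := by
    rw [← wval_msk L inp hzz ht]; exact wval_congr fun i hi => by unfold inpADD; rw [if_neg (by omega), Nat.add_sub_cancel_left]
  have hS : valR L inp (t + 1) = wval (fun i => wireVal (Adder.addT false L) (inpADD L inp t) (2 * i + 1)) L :=
    wval_congr fun i hi => by
      simp only [rv, RRef, Nat.add_eq_zero_iff, one_ne_zero, and_false, if_false, refVal, Nat.add_sub_cancel]
      rw [show t * PS L + L + (2 * i + 1) = t * PS L + L + (2 * i + 1) from rfl]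
      exact wireVal_ADD L inp ht (by simp; omega)
  rw [hx, hy, Bool.toNat_false, Nat.add_zero] at hA
  rw [hS]
  -- `S + c 2^L = R_t + mask_t`, so `S = (R_t + mask_t) mod 2^L`
  have hSlt := wval_lt (fun i => wireVal (Adder.addT false L) (inpADD L inp t) (2 * i + 1)) L
  rw [← hA, Nat.add_mul_mod_self_right, Nat.mod_eq_of_lt hSlt]

/-- **The invariant of shift-and-add**: `R_t = a · (b mod 2^t) mod 2^L` for `t ≤ L` (`zz = 0`).
[cite: Vollmer1999, §1.2] -/
theorem valR_eq (hzz : inp (2 * L) = false) : ∀ {t : ℕ}, t ≤ L → valR L inp t = valA L inp * (valB L inp % 2 ^ t) % 2 ^ L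
  | 0, _ => by rw [valR_zero L inp hzz, Nat.pow_zero, Nat.mod_one, Nat.mul_zero, Nat.zero_mod]
  | t + 1, ht => by
    have ih := valR_eq hzz (t := t) (by omega)
    have hbit : inp (L + t) = (valB L inp).testBit t := (testBit_wval (fun i => inp (L + i)) (W := L) (by omega)).symm
    rw [valR_succ L inp hzz (by omega), ih, hbit, Nat.mod_pow_succ, Nat.toNat_testBit]
    calc _ ≡ valA L inp * (valB L inp % 2 ^ t) + valB L inp / 2 ^ t % 2 * (valA L inp * 2 ^ t) [MOD 2 ^ L] :=
        (Nat.mod_modEq _ _).add ((Nat.mod_modEq _ _).mul_left _)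
      _ = _ := by ring

/-- **The plain multiplier multiplies modulo `2^L`**: the output word `R_L` of `mulPT L` — the sum
bits of the last adder, gates `(L-1)·PS L + L + (2j+1)`, i.e. the variables `Plain.Mul.Rw L o L j`
of an occurrence — carries `a · b mod 2^L` (`zz = 0`). [cite: Vollmer1999, §1.2] -/
theorem wval_mulPT (hzz : inp (2 * L) = false) : valR L inp L = valA L inp * valB L inp % 2 ^ L := by
  rw [valR_eq L inp hzz le_rfl, Nat.mod_eq_of_lt (show valB L inp < 2 ^ L from wval_lt _ L)]

/-- The output word read as gates (`0 < L`). [folklore] -/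
theorem valR_out (hL : 0 < L) :
    valR L inp L = wval (fun j => wireVal (mulPT L) inp ((L - 1) * PS L + L + (2 * j + 1))) L :=
  wval_congr fun j _ => by simp only [rv, RRef, Nat.pos_iff_ne_zero.1 hL, if_false, refVal]

/-- Without overflow the plain multiplier multiplies: `R_L = a · b` when `a · b < 2^L`. [cite: Vollmer1999, §1.2] -/
theorem wval_mulPT_of_lt (hzz : inp (2 * L) = false) (h : valA L inp * valB L inp < 2 ^ L) :
    valR L inp L = valA L inp * valB L inp := by
  rw [wval_mulPT L inp hzz, Nat.mod_eq_of_lt h]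

end Plain.Mul

end Literature.Computability.MetaComplexity
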